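import Mathlib
import Literature.MathematicalPhysics.QuantumFieldTheory.Balaban1983to89.B10SectAStatements
import Literature.MathematicalPhysics.QuantumFieldTheory.Balaban1983to89.B12LinearizAnalytic267
import Literature.MathematicalPhysics.QuantumFieldTheory.Balaban1983to89.B10Eq20Locality
import Literature.MathematicalPhysics.QuantumFieldTheory.Balaban1983to89.B8SectDSource
import HarnessLib

/-!
# `Balaban1983to89.B10Eq17LocalSolution` — T. Bałaban, *Ultraviolet stability of three-dimensional lattice pure
gauge field theories*, Commun. Math. Phys. **102** (1985) 255–275 [Balaban1985UV3], display (17) pp. 259–260: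
«There exists a unique solution D̃ of this equation for A sufficiently small, and it is an analytic function of A
with a Taylor expansion beginning with second order terms» — the print-faithful (LOCAL) reading `Eq17Local`,
PROVED for every nonlinearity `C̃` with the printed quadratic bound and analyticity and every bounded linear `h`,
by name from the cell's contraction scheme; the refutation of the GLOBAL reading typed in
`B10SectAStatements.Eq17`; and the local form of the p. 260 locality consequence

statement-level skeleton of published theorems with citation tags; proofs where landed; nothing here is a claim about
the Yang–Mills mass gap

PDF held: `paper:balaban1985-cmp102-uv-stability-3d` (journal page = PDF page + 254); p. 259 = `p0005.txt`, p. 260 =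
`p0006.txt`; renders `run/shared/lean/pub/pub-balaban/b2b-balaban-ref1/pages/1985-cmp102-uv-stability-3d/…-p006-x2.png`.

CITATION HEADER.  WHAT IS REPRODUCED: SKELETON row `B10.Eq17` of the mega-formalization `lit-balaban`
(`run/shared/lean/pub/lit-balaban/SKELETON.md` §B10; NE-spine interface `INTERFACES.md` §1.3 row `B10.Eq17-18`,
F-T4-150).  The print, p. 259–260 [PDF 5–6], verbatim: *«Thus we are looking for a function D̃(A, b, c) satisfying the
equation Q(A − D̃(A, c), c) = (QA)(c) − QD̃(A, c) + C(A − D̃(A, c), c) = (QA)(c), (17) or QD̃(A, c) = C(A − D̃(A, c), c).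
… We assume that D̃(A, b, c) = 0 for all b ≠ b₀(c). This assures the locality properties. We have analyzed the
equations of the type (17) several times already, see Sect. E in [6], Sect. C in [7]. There exists a unique solution
D̃ of this equation for A sufficiently small, and it is an analytic function of A with a Taylor expansion beginning
with second order terms.»*  The template «Sect. C in [7]» = [Balaban1985Variational] p. 286 [PDF 10] (render
`…1985-cmp102-variational-background-p010-x2.png`, quoted in the tree module `B13Contraction113`): *«The contraction
maping theorem implies that for arbitrary A′, satisfying L^jη|A′| < ε₃ on Ω_j, there exists exactly one fixed point of
the transformation (50), thus exactly one solution of Eq. (49). This solution is a limit of uniformly convergent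
sequence of successive approximations and it is an analytic function of A′. It satisfies the bound |D(A′)| < ε₃/B₀ …
|D(A′)| ≦ 4C₂|A′|²_{(−1)}. (55)»* — existence and uniqueness IN A BALL of configurations.

FOLD-OWNER FINDING (unit `lit-balaban-r07`, gen 9, on its own gen-1 typing `B10SectAStatements.Eq17`, p239320).  Clause
(i) of `Eq17 𝕜 b₀ h Ct r Dt` reads «a unique solution» as `∀ D, IsFixedPt (fpMap b₀ h Ct A) D → D = Dt A`, i.e.
uniqueness among ALL `D : C → X`.  Print's uniqueness is local (the solution space of [7] (50) is `|X| < ε₃/B₀`), and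
the global reading is not a consequence of the printed hypotheses: for the one-bond nonlinearity `C̃(A) = A²`
(`sqCt`; quadratic bound with `C₂ = 1`, entire) and `h = id`, at `A = 0` both `D = 0` and `D = 1` solve
`D = C̃(0 − hD)`, so NO `(r, Dt)` satisfies `Eq17` (`not_eq17_sqCt`), while the local statement holds
(`eq17Local_sqCt`).  The typed READING is therefore refuted AS TYPED (print not at fault); the landed `Eq17` is kept
(it is satisfiable for globally contracting cut-off models, and its uniqueness clause has the global shape of the
hypothesis `huniq` of `B13PkLocalTerms.fixedPt_fpMap_apply_eq` / `B10Eq20Locality.eq20_of_fixedPt`), and the row is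
re-typed here:

* `Eq17Local 𝕜 b₀ h Ct r δ Dt` [cite] — for `‖A‖ < r`: `Dt A` is a fixed point of `D ↦ C̃(A − hD)`
  (`B13PkLocalTerms.fpMap`), `‖Dt A‖ ≤ δ`, and it is the ONLY fixed point with `‖D‖ ≤ δ`; `Dt` is analytic on the
  ball `‖A‖ < r`; `Dt 0 = 0` and `DDt(0) = 0` («Taylor expansion beginning with second order terms»).
* `exists_solution` / `exists_eq17Local` — THE PRINTED SENTENCE AS A THEOREM over `𝕜 = ℂ`: for `X` a complex
  Banach space (the complexified Lie algebra `𝔤ᶜ` on the finite lattice), finite bond types `β`, `C` with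
  `b₀ : C → β`, `h c : X →ₗ[ℂ] X` with `‖h c x‖ ≤ b‖x‖`, and `C̃ : (β → X) → (C → X)` with
  `B13Contraction113.QuadAnalytic C̃ C₂ R` (the printed quadratic bound `‖C̃(Y)‖ ≤ C₂‖Y‖²` and analyticity along
  complex lines on `‖Y‖ < R`) and `AnalyticOnNhd ℂ C̃ {‖Y‖ < R}`: for every `ε > 0` with `9C₂bε < 1`, `3ε ≤ R`
  ([7]'s contraction condition «9C₂B₀ε₃ ≦ 1/2» made a hypothesis, as in the cell's modules) there is `Dt` with
  `Eq17Local ℂ b₀ h C̃ ε (4C₂ε²) Dt`, which is moreover the only solution `D` with `‖hD‖ < ε` ([7] p. 286 «exactly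
  one fixed point … |D(A′)| < ε₃/B₀», by the Lipschitz bound (54) on `‖Y‖ < 2ε`).  Proof BY NAME:
  existence/uniqueness in the closed ball `4C₂ε²` = `B12Lineariz267.exists_Dt` / `eq_Dt_of_fixedPt` (Banach's
  theorem, `B13Contraction113.exists_unique_fixedPoint`); analyticity = `B12LinearizAnalytic267.analyticOnNhd_Dt`
  (Mathlib's analytic implicit function theorem `ContDiffAt.implicitFunction`, `n = ω`); `Dt 0 = 0` from (55)
  `B12Lineariz267.norm_Dt_le`; `DDt(0) = 0` from `B12LinearizAnalytic267.hasStrictFDerivAt_Dt` + `norm_fderiv_Dt_le`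
  (`‖DD̃(B₀)‖ ≤ 9C₂‖B₀‖(1 − 9C₂bε)⁻¹`); print's uniqueness from `B12LinearizAnalytic267.norm_sub_le_of_lt_two` +
  `B12Lineariz267.mapsTo_phi`.  The instantiation is `𝒴 := (β → X)`, `𝒳 := (C → X)` (sup norms) and
  `hop := hOpLin b₀ h`, the printed support structure `B13PkLocalTerms.hOp` («D̃(A, b, c) = 0 for all b ≠ b₀(c)»)
  as a linear map, with `‖hOp D‖ ≤ b‖D‖` (`norm_hOp_le`); `exists_radius_eq17Local` removes the choice of `ε`.
* `eq17Local_of_eq17` — the global typing implies the local one (for any bound `δ` on the solution).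
* `fixedPt_fpMap_apply_eq_local` — p. 260 «The function D̃(A, c), similarly as Q(A′, c), depends on A restricted to
  B(c₋) ∪ B(c₊)» from LOCAL existence/uniqueness only (the cell's `B13PkLocalTerms.fixedPt_fpMap_apply_eq` assumes the
  global pair): if `B`, `B′` in the ball agree on the dependence set `N(c)` of `C̃(·)(c)` then `Dt B c = Dt B′ c`
  (patch the `c`-component; sup norms keep the patch in the `δ`-ball).
* `eq20_of_local` / `Eq17Local.eq20` / `Eq17Local.eq20_exp_sum_log` — (20) p. 261 «exp Tr log(I − (δ/δA)D̃(A)) =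
  exp[Σ_c tr log(1 − (∂/∂A(b₀(c)))D̃(A, b₀(c), c))]» for THE local solution: in coordinates `X = ι → 𝕜`, for `‖A‖ < r`
  and any Fréchet derivative `L` of `A ↦ hD̃(A)` at `A`, `det(I − L) = Π_c det(1 − J_c)` (and the `exp Σ log` form
  over `ℂ`) — the cell's `B10Eq20Locality.eq20_of_fixedPt` needed GLOBAL existence/uniqueness (`hfix`/`huniq` for all
  `A` and all `D`, the shape refuted above for print-admissible data); here the zero off-diagonal coarse blocks come from locality along
  short line segments inside the ball (`apply_eq_zero_of_eventually_add_smul`) and the determinant identity is the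
  cell's `B10Eq20Locality.det_one_sub_eq_prod` by name.  So rows B10.Eq17 → B10.Eq20 are now linked through
  statements that ARE consequences of print's hypotheses.

* v1.1 (same unit/gen) §6 `exists_eq17Local_real_core` / `exists_eq17Local_real` — REAL scalars, print's own
  setting (A is 𝔤-valued, «analytic» = real-analytic): if `C̃` is `ContDiffOn ℝ ω` on a ball around `0` with
  `C̃(0) = 0`, `DC̃(0) = 0` and `h(c)` are linear with `‖h c x‖ ≤ b‖x‖`, then `Eq17Local ℝ b₀ h C̃ r δ Dt` holds for
  some `r, δ > 0` (explicit-radius form in the core theorem: `‖DC̃‖ ≤ κ` on `‖Y‖ < ρ ≤ R`, `κb < 1`, `r + bδ ≤ ρ`,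
  `κ(r + bδ) ≤ δ`).  A DIRECT proof (not by name): Banach's theorem in the closed ball `δ`
  (`B8SectDSource.fixedPoint_closedBall`), Lipschitz dependence of the fixed point on `A`, and Mathlib's `C^ω`
  implicit function theorem over `ℝ` (`ContDiffAt.implicitFunction`, `contDiffAt_implicitFunction`,
  `hasStrictFDerivAt_implicitFunction`, `eventually_apply_eq_iff_implicitFunction`) identified with the fixed point by
  local uniqueness; `DDt(0) = −(∂₂F)⁻¹∘∂₁F = 0` because `∂₁F(0, 0) = −DC̃(0) = 0`.

* v1.2 (same unit, gen 13) §7 `eq_of_isFixedPt_of_fderiv_le` / `Eq17Local.eq_of_isFixedPt_real` /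
  `exists_solution_real` / `existsUnique_solution_real` — REAL scalars, the uniqueness clause IN PRINT'S OWN SOLUTION
  SPACE ([7] p. 286 «exactly one fixed point … It satisfies the bound |D(A′)| < ε₃/B₀»), the ℝ mirror of the last
  clause of `exists_solution`: two fixed points of `D ↦ C̃(A − hD)` whose arguments lie in the ball where
  `‖DC̃‖ ≤ κ`, `κb < 1`, coincide (mean-value Lipschitz bound, `‖D₁ − D₂‖ ≤ κb‖D₁ − D₂‖`); hence with the radii of
  `exists_eq17Local_real` (`r = ρ/4`) the real local solution satisfies `‖hD̃(A)‖ < 3r` and is the ONLY solution with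
  `‖hD‖ < 3r` for `‖A‖ < r` — «a unique solution … for A sufficiently small» as an `∃!`.

Nothing of [Balaban1985UV3] beyond these finite-dimensional statements is asserted; the identification of print's
concrete `Q(A′, c)` of (14)–(15) (products of exponentials, logarithm) with abstract data `(C̃, h, b₀)` and the
verification of the quadratic bound for it are NOT done here (they are [6] Sect. E / [7] Prop. 4 business, rows
`B8.Eq1.125`, `B11.Prop4`).  Unit `lit-balaban-r07` gens 9 (v1, v1.1), 13 (v1.2); rows in `run/shared/lean/pub/lit-balaban/lit-balaban-r07/ROWS-B10.md`.
-/

open Metric Set Filter Topology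
open scoped ContDiff

namespace Literature.MathematicalPhysics.QuantumFieldTheory.Balaban1983to89.B10Eq17LocalSolution

open B13PkLocalTerms B13Contraction113 B12Lineariz267 B12LinearizAnalytic267 B10SectAStatements

/-! ## §0  The support operator `hD̃` of p. 260 as a linear map, and its sup-norm bound -/

section HOp

variable {𝕜 : Type*} [NontriviallyNormedField 𝕜] {β C X : Type*} [NormedAddCommGroup X] [NormedSpace 𝕜 X]

/-- Value of `hOp b₀ h D` at a bond `b` (no injectivity of `b₀` needed): either `h c (D c)` for some `c` with
`b₀ c = b`, or `0` (off the range of `b₀`). [cite: Balaban1985UV3, (17) p.260] -/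
theorem hOp_apply_cases (b₀ : C → β) (h : C → X → X) (D : C → X) (b : β) :
    (∃ c, b₀ c = b ∧ hOp b₀ h D b = h c (D c)) ∨ hOp b₀ h D b = 0 := by
  classical
  by_cases hb : ∃ c, b₀ c = b
  · refine Or.inl ⟨Classical.choose hb, Classical.choose_spec hb, ?_⟩
    simp only [hOp, Function.extend_def, dif_pos hb]
  · exact Or.inr (hOp_eq_zero_off_range h D hb)

/-- `hOp` is additive in `D` when every `h c` is additive. [cite: Balaban1985UV3, (17) p.260] -/
theorem hOp_add (b₀ : C → β) (h : C → X →ₗ[𝕜] X) (D D' : C → X) :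
    hOp b₀ (fun c => ⇑(h c)) (D + D') = hOp b₀ (fun c => ⇑(h c)) D + hOp b₀ (fun c => ⇑(h c)) D' := by
  classical
  funext b
  simp only [hOp, Pi.add_apply]
  by_cases hb : ∃ c, b₀ c = b
  · simp only [Function.extend_def, dif_pos hb, map_add]
  · simp only [Function.extend_apply' _ _ _ hb, Pi.zero_apply, add_zero]

/-- `hOp` commutes with scalars when every `h c` is `𝕜`-linear. [cite: Balaban1985UV3, (17) p.260] -/
theorem hOp_smul (b₀ : C → β) (h : C → X →ₗ[𝕜] X) (a : 𝕜) (D : C → X) :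
    hOp b₀ (fun c => ⇑(h c)) (a • D) = a • hOp b₀ (fun c => ⇑(h c)) D := by
  classical
  funext b
  simp only [hOp, Pi.smul_apply]
  by_cases hb : ∃ c, b₀ c = b
  · simp only [Function.extend_def, dif_pos hb, map_smul]
  · simp only [Function.extend_apply' _ _ _ hb, Pi.zero_apply, smul_zero]

/-- **`hD̃` as a `𝕜`-linear map** `(C → X) →ₗ[𝕜] (β → X)` (p. 260: D̃(A, ·, c) supported at the single bond b₀(c);
[Balaban1987RG1] p. 267: «(hB)(b₀(c)) = h(c)B(c), where h(c) is a linear operator on the Lie algebra g»), for linear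
`h c`. [cite: Balaban1985UV3, (17) p.260] -/
noncomputable def hOpLin (b₀ : C → β) (h : C → X →ₗ[𝕜] X) : (C → X) →ₗ[𝕜] (β → X) where
  toFun D := hOp b₀ (fun c => ⇑(h c)) D
  map_add' := hOp_add b₀ h
  map_smul' a D := by rw [RingHom.id_apply]; exact hOp_smul b₀ h a D

/-- Unfolding `hOpLin`. [cite: Balaban1985UV3, (17) p.260] -/
theorem hOpLin_apply (b₀ : C → β) (h : C → X →ₗ[𝕜] X) (D : C → X) :
    hOpLin b₀ h D = hOp b₀ (fun c => ⇑(h c)) D := rfl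

/-- The fixed-point map of (17) in terms of `hOpLin`: `fpMap b₀ h C̃ A D = C̃ (A − hOpLin b₀ h D)`. [cite: Balaban1985UV3, (17) p.260] -/
theorem fpMap_eq_hOpLin (b₀ : C → β) (h : C → X →ₗ[𝕜] X) (Ct : (β → X) → C → X) (A : β → X) (D : C → X) :
    fpMap b₀ (fun c => ⇑(h c)) Ct A D = Ct (A - hOpLin b₀ h D) := rfl

variable [Fintype β] [Fintype C]

/-- **Sup-norm bound of the support operator**: `‖hOp b₀ h D‖ ≤ b·‖D‖` when `‖h c x‖ ≤ b‖x‖` for all `c`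
(one non-zero entry `h(c)D(c)` per coarse bond). [cite: Balaban1985UV3, (17) p.260] -/
theorem norm_hOp_le (b₀ : C → β) (h : C → X → X) {b : ℝ} (hb : 0 ≤ b) (hh : ∀ c x, ‖h c x‖ ≤ b * ‖x‖)
    (D : C → X) : ‖hOp b₀ h D‖ ≤ b * ‖D‖ := by
  refine (pi_norm_le_iff_of_nonneg (by positivity)).2 fun bd => ?_
  rcases hOp_apply_cases b₀ h D bd with ⟨c, -, hc⟩ | h0
  · rw [hc]
    exact (hh c (D c)).trans (mul_le_mul_of_nonneg_left (norm_le_pi_norm D c) hb)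
  · rw [h0, norm_zero]
    positivity

/-- The same bound for `hOpLin`. [cite: Balaban1985UV3, (17) p.260] -/
theorem norm_hOpLin_le (b₀ : C → β) (h : C → X →ₗ[𝕜] X) {b : ℝ} (hb : 0 ≤ b)
    (hh : ∀ c x, ‖h c x‖ ≤ b * ‖x‖) (D : C → X) : ‖hOpLin b₀ h D‖ ≤ b * ‖D‖ :=
  norm_hOp_le b₀ (fun c => ⇑(h c)) hb hh D

end HOp

/-! ## §1  The print-faithful (local) statement of (17) -/

section Statement

variable {β C X : Type*} [Fintype β] [Fintype C] [NormedAddCommGroup X]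

/-- **(17) pp. 259–260 [5–6], local reading**, verbatim print: *«QD̃(A, c) = C(A − D̃(A, c), c). … We assume that
D̃(A, b, c) = 0 for all b ≠ b₀(c). … There exists a unique solution D̃ of this equation for A sufficiently small, and it
is an analytic function of A with a Taylor expansion beginning with second order terms.»* — typed over the cell's
fixed-point form `B13PkLocalTerms.fpMap b₀ h Ct A : (C → X) → (C → X)`, `D ↦ C̃(A − hD)`: with `r` = «A sufficiently
small» and `δ` = the radius of the solution space ([7] Sect. C p. 286: the fixed point is sought among `|X| < ε₃/B₀`
and obeys `|D(A′)| ≦ 4C₂|A′|²` (55)): for `‖A‖ < r`, (i) `Dt A` solves the equation, `‖Dt A‖ ≤ δ`, and every solution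
`D` with `‖D‖ ≤ δ` equals `Dt A`; (ii) `Dt` is analytic (over `𝕜`) on the ball `‖A‖ < r`; (iii) `Dt 0 = 0` and the
Fréchet derivative of `Dt` at `0` vanishes.  Differs from `B10SectAStatements.Eq17` exactly in the uniqueness clause
(there: among ALL `D`; see `not_eq17_sqCt`). [cite: Balaban1985UV3, (17) pp.259–260] -/
def Eq17Local (𝕜 : Type*) [NontriviallyNormedField 𝕜] [NormedSpace 𝕜 X] (b₀ : C → β) (h : C → X → X)
    (Ct : (β → X) → C → X) (r δ : ℝ) (Dt : (β → X) → (C → X)) : Prop :=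
  0 < r ∧ 0 ≤ δ ∧
    (∀ A : β → X, ‖A‖ < r →
      Function.IsFixedPt (fpMap b₀ h Ct A) (Dt A) ∧ ‖Dt A‖ ≤ δ ∧
        ∀ D : C → X, ‖D‖ ≤ δ → Function.IsFixedPt (fpMap b₀ h Ct A) D → D = Dt A) ∧
    AnalyticOn 𝕜 Dt (Metric.ball 0 r) ∧
    Dt 0 = 0 ∧ HasFDerivAt Dt (0 : (β → X) →L[𝕜] (C → X)) 0

/-- The GLOBAL typing `Eq17` implies the local one, for any bound `δ ≥ 0` on the solution on the ball. [cite: Balaban1985UV3, (17) pp.259–260] -/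
theorem eq17Local_of_eq17 {𝕜 : Type*} [NontriviallyNormedField 𝕜] [NormedSpace 𝕜 X] {b₀ : C → β}
    {h : C → X → X} {Ct : (β → X) → C → X} {r δ : ℝ} {Dt : (β → X) → (C → X)}
    (h17 : Eq17 𝕜 b₀ h Ct r Dt) (hδ : 0 ≤ δ) (hball : ∀ A : β → X, ‖A‖ < r → ‖Dt A‖ ≤ δ) :
    Eq17Local 𝕜 b₀ h Ct r δ Dt := by
  obtain ⟨hr, hfix, han, h0, hd⟩ := h17
  exact ⟨hr, hδ, fun A hA => ⟨(hfix A hA).1, hball A hA, fun D _ hD => (hfix A hA).2 D hD⟩, han, h0, hd⟩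

end Statement

/-! ## §2  The printed sentence as a theorem (complex scalars) -/

section Solution

variable {X : Type*} [NormedAddCommGroup X] [NormedSpace ℂ X] [CompleteSpace X]
  {β C : Type*} [Fintype β] [Fintype C]

/-- **«There exists a unique solution D̃ of this equation for A sufficiently small, and it is an analytic function of
A with a Taylor expansion beginning with second order terms» — PROVED in the local reading**, for every nonlinearity
`C̃` with the printed quadratic bound and analyticity (`B13Contraction113.QuadAnalytic C̃ C₂ R` + `AnalyticOnNhd ℂ C̃`
on `‖Y‖ < R`) and every family of bounded linear `h(c)` (`‖h c x‖ ≤ b‖x‖`): for `0 < ε`, `9C₂bε < 1`, `3ε ≤ R`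
there is `Dt` with `Eq17Local ℂ b₀ h C̃ ε (4C₂ε²) Dt`, AND uniqueness in print's own solution space ([7] p. 286
«exactly one fixed point … It satisfies the bound |D(A′)| < ε₃/B₀»): for `‖A‖ < ε`, every solution `D` with
`‖hD‖ < ε` equals `Dt A`.  Proof by name from the cell's kernel of «Sect. C in [7]»: `B12Lineariz267.exists_Dt` /
`eq_Dt_of_fixedPt` / `norm_Dt_le` / `mapsTo_phi` (Banach's theorem in the closed ball `4C₂ε²`,
`B13Contraction113.exists_unique_fixedPoint`; (55)), `B12LinearizAnalytic267.analyticOnNhd_Dt` /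
`hasStrictFDerivAt_Dt` / `norm_fderiv_Dt_le` (Mathlib's analytic implicit function theorem) and
`norm_sub_le_of_lt_two` (the Lipschitz bound `9C₂ε` of `C̃` on `‖Y‖ < 2ε`, [7] (54)), on `𝒴 = (β → X)`,
`𝒳 = (C → X)`, `hop = hOpLin b₀ h`. [cite: Balaban1985UV3, (17) pp.259–260] -/
theorem exists_solution (b₀ : C → β) (h : C → X →ₗ[ℂ] X) {Ct : (β → X) → C → X} {C₂ R b ε : ℝ}
    (hC : QuadAnalytic Ct C₂ R) (hCa : AnalyticOnNhd ℂ Ct {Y : β → X | ‖Y‖ < R}) (hC₂ : 0 ≤ C₂) (hb : 0 ≤ b)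
    (hh : ∀ c x, ‖h c x‖ ≤ b * ‖x‖) (hε : 0 < ε) (hq : 9 * C₂ * b * ε < 1) (hRC : 3 * ε ≤ R) :
    ∃ Dt : (β → X) → (C → X), Eq17Local ℂ b₀ (fun c => ⇑(h c)) Ct ε (4 * C₂ * ε ^ 2) Dt ∧
      ∀ A : β → X, ‖A‖ < ε → ∀ D : C → X, ‖hOpLin b₀ h D‖ < ε →
        Function.IsFixedPt (fpMap b₀ (fun c => ⇑(h c)) Ct A) D → D = Dt A := by
  have hHop : ∀ D : C → X, ‖hOpLin b₀ h D‖ ≤ b * ‖D‖ := norm_hOpLin_le b₀ h hb hh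
  obtain ⟨Dt, hDt⟩ := exists_Dt hC hC₂ hb hHop hq hRC
  have hDball : ∀ B : β → X, ‖B‖ < ε → Dt B ∈ closedBall (0 : C → X) (4 * C₂ * ε ^ 2) :=
    fun B hB => (hDt B hB).1
  have hDfix : ∀ B : β → X, ‖B‖ < ε → Ct (B - hOpLin b₀ h (Dt B)) = Dt B := fun B hB => (hDt B hB).2
  have h0 : ‖(0 : β → X)‖ < ε := by simpa using hε
  refine ⟨Dt, ⟨hε, by positivity, fun A hA => ⟨?_, ?_, ?_⟩, ?_, ?_, ?_⟩, fun A hA D hD hfixD => ?_⟩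
  · change Ct (A - hOpLin b₀ h (Dt A)) = Dt A
    exact hDfix A hA
  · exact mem_closedBall_zero_iff.mp (hDball A hA)
  · intro D hD hfixD
    change Ct (A - hOpLin b₀ h D) = D at hfixD
    exact eq_Dt_of_fixedPt hC hC₂ hb hHop hq hRC hDball hDfix hA (mem_closedBall_zero_iff.mpr hD) hfixD
  · exact (analyticOnNhd_Dt hC hCa hC₂ hb hHop hq hRC hDball hDfix).analyticOn
  · have hn := norm_Dt_le hC hC₂ hb hHop hq hRC hDball hDfix h0
    simp only [norm_zero] at hn
    exact norm_le_zero_iff.mp (by nlinarith [hn])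
  · have hd := (hasStrictFDerivAt_Dt hC hCa hC₂ hb hHop hq hRC hDball hDfix h0).hasFDerivAt
    have hn := norm_fderiv_Dt_le hC hCa hC₂ hb hHop hq hRC hDball hDfix h0
    simp only [norm_zero, mul_zero, zero_mul] at hn
    have hz : fderiv ℂ Dt 0 = 0 := norm_le_zero_iff.mp hn
    have hd' := hd.differentiableAt.hasFDerivAt
    rwa [hz] at hd'
  · -- uniqueness among `‖hD‖ < ε` ([7] (54): contraction on `‖Y‖ < 2ε`)
    change Ct (A - hOpLin b₀ h D) = D at hfixD
    have hY : ‖A - hOpLin b₀ h D‖ < 2 * ε :=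
      calc ‖A - hOpLin b₀ h D‖ ≤ ‖A‖ + ‖hOpLin b₀ h D‖ := norm_sub_le _ _
        _ < ε + ε := add_lt_add hA hD
        _ = 2 * ε := by ring
    have hY' : ‖A - hOpLin b₀ h (Dt A)‖ < 2 * ε :=
      mem_ball_zero_iff.mp (mapsTo_phi hC hC₂ hb hHop hq hRC hDball hDfix (mem_ball_zero_iff.mpr hA))
    have hlip := norm_sub_le_of_lt_two hCa.differentiableOn hC.quad hC₂ hRC hY hY'
    rw [hfixD, hDfix A hA, sub_sub_sub_cancel_left, ← map_sub] at hlip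
    have h2 : ‖hOpLin b₀ h (Dt A - D)‖ ≤ b * ‖D - Dt A‖ := (hHop _).trans_eq (by rw [norm_sub_rev])
    have h3 : ‖D - Dt A‖ ≤ 9 * C₂ * ε * (b * ‖D - Dt A‖) :=
      hlip.trans (mul_le_mul_of_nonneg_left h2 (by positivity))
    by_contra hne
    have hpos : 0 < ‖D - Dt A‖ := norm_pos_iff.mpr (sub_ne_zero.mpr hne)
    nlinarith

/-- The `Eq17Local` half of `exists_solution`. [cite: Balaban1985UV3, (17) pp.259–260] -/
theorem exists_eq17Local (b₀ : C → β) (h : C → X →ₗ[ℂ] X) {Ct : (β → X) → C → X} {C₂ R b ε : ℝ}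
    (hC : QuadAnalytic Ct C₂ R) (hCa : AnalyticOnNhd ℂ Ct {Y : β → X | ‖Y‖ < R}) (hC₂ : 0 ≤ C₂) (hb : 0 ≤ b)
    (hh : ∀ c x, ‖h c x‖ ≤ b * ‖x‖) (hε : 0 < ε) (hq : 9 * C₂ * b * ε < 1) (hRC : 3 * ε ≤ R) :
    ∃ Dt : (β → X) → (C → X), Eq17Local ℂ b₀ (fun c => ⇑(h c)) Ct ε (4 * C₂ * ε ^ 2) Dt := by
  obtain ⟨Dt, h17, -⟩ := exists_solution b₀ h hC hCa hC₂ hb hh hε hq hRC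
  exact ⟨Dt, h17⟩

/-- **«for A sufficiently small»: the radius chosen** — for every `C̃`, `h` as above with `R > 0` there are `ε > 0` and
`Dt` with `Eq17Local ℂ b₀ h C̃ ε (4C₂ε²) Dt` (take `ε = min(R/3, (9C₂b + 1)⁻¹)`). [cite: Balaban1985UV3, (17) pp.259–260] -/
theorem exists_radius_eq17Local (b₀ : C → β) (h : C → X →ₗ[ℂ] X) {Ct : (β → X) → C → X} {C₂ R b : ℝ}
    (hC : QuadAnalytic Ct C₂ R) (hCa : AnalyticOnNhd ℂ Ct {Y : β → X | ‖Y‖ < R}) (hC₂ : 0 ≤ C₂) (hb : 0 ≤ b)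
    (hh : ∀ c x, ‖h c x‖ ≤ b * ‖x‖) (hR : 0 < R) :
    ∃ ε : ℝ, 0 < ε ∧ ∃ Dt : (β → X) → (C → X), Eq17Local ℂ b₀ (fun c => ⇑(h c)) Ct ε (4 * C₂ * ε ^ 2) Dt := by
  set ε : ℝ := min (R / 3) (9 * C₂ * b + 1)⁻¹ with hεdef
  have hpos : 0 < 9 * C₂ * b + 1 := by positivity
  have hε : 0 < ε := lt_min (by positivity) (inv_pos.mpr hpos)
  have hRC : 3 * ε ≤ R := by
    have : ε ≤ R / 3 := min_le_left _ _
    linarith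
  have hq : 9 * C₂ * b * ε < 1 := by
    have h1 : ε ≤ (9 * C₂ * b + 1)⁻¹ := min_le_right _ _
    have h2 : 9 * C₂ * b * ε ≤ 9 * C₂ * b * (9 * C₂ * b + 1)⁻¹ :=
      mul_le_mul_of_nonneg_left h1 (by positivity)
    have h3 : 9 * C₂ * b * (9 * C₂ * b + 1)⁻¹ < 1 := by
      rw [← div_eq_mul_inv, div_lt_one hpos]
      linarith
    exact h2.trans_lt h3
  exact ⟨ε, hε, exists_eq17Local b₀ h hC hCa hC₂ hb hh hε hq hRC⟩

end Solution

/-! ## §3  The global reading `Eq17` is refuted as typed (print not at fault) -/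

section Refutation

/-- The one-bond nonlinearity `C̃(A) = A(·)²` (`X = ℂ`, `β = C = Unit`): print-admissible data (quadratic bound with
`C₂ = 1` on every ball, entire). [folklore] -/
def sqCt : (Unit → ℂ) → Unit → ℂ := fun A _ => (A ()) ^ 2

/-- With `b₀ = id` and `h(c) = id`, `hOp` is the identity on one-bond fields. [folklore] -/
private theorem hOp_id_apply (D : Unit → ℂ) (u : Unit) : hOp id (fun (_ : Unit) (x : ℂ) => x) D u = D u := by
  have := hOp_apply_b₀ Function.injective_id (fun (_ : Unit) (x : ℂ) => x) D u
  simpa using this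

/-- `sqCt` satisfies the printed quadratic bound with `C₂ = 1` and is holomorphic along complex lines, on every ball.
[folklore] -/
private theorem quadAnalytic_sqCt (R : ℝ) : QuadAnalytic sqCt 1 R where
  quad Y _ := by
    rw [one_mul]
    refine (pi_norm_le_iff_of_nonneg (by positivity)).2 fun u => ?_
    simp only [sqCt, norm_pow]
    exact pow_le_pow_left₀ (norm_nonneg _) (norm_le_pi_norm Y ()) 2
  lineAnalytic P Q := by
    refine (Differentiable.differentiableOn (differentiable_pi.mpr fun u => ?_))
    simp only [sqCt, Pi.add_apply, Pi.smul_apply, smul_eq_mul]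
    fun_prop

/-- `sqCt` is complex-analytic everywhere (in particular on `‖Y‖ < R`). [folklore] -/
private theorem analyticOnNhd_sqCt (S : Set (Unit → ℂ)) : AnalyticOnNhd ℂ sqCt S := by
  intro A _
  have hproj : AnalyticAt ℂ (fun Y : Unit → ℂ => Y ()) A :=
    (ContinuousLinearMap.proj (R := ℂ) (φ := fun _ : Unit => ℂ) ()).analyticAt A
  have hsq : AnalyticAt ℂ (fun Y : Unit → ℂ => Y () ^ 2) A := hproj.pow 2
  have : AnalyticAt ℂ (fun Y : Unit → ℂ => fun _ : Unit => Y () ^ 2) A := analyticAt_pi_iff.mpr fun _ => hsq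
  exact this

/-- The counterexample data are print-admissible: `sqCt` obeys the quadratic bound with `C₂ = 1` on every ball, is
holomorphic along complex lines, and is analytic everywhere — i.e. it satisfies the hypotheses of `exists_solution`
(with `h = id`, `b = 1`). [cite: Balaban1985UV3, (17) pp.259–260] -/
theorem sqCt_admissible (R : ℝ) (S : Set (Unit → ℂ)) : QuadAnalytic sqCt 1 R ∧ AnalyticOnNhd ℂ sqCt S :=
  ⟨quadAnalytic_sqCt R, analyticOnNhd_sqCt S⟩

/-- **The GLOBAL uniqueness clause of `B10SectAStatements.Eq17` fails for print-admissible data**: for `C̃ = sqCt`,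
`h = id`, at `A = 0` both `D = 0` and `D = 1` are fixed points of `D ↦ C̃(0 − hD) = D²`, so no `(r, Dt)` satisfies
`Eq17` — the typed reading is stronger than print's «a unique solution … for A sufficiently small» (local, [7]
p. 286). [cite: Balaban1985UV3, (17) pp.259–260] -/
theorem not_eq17_sqCt (r : ℝ) (Dt : (Unit → ℂ) → Unit → ℂ) :
    ¬ Eq17 ℂ id (fun (_ : Unit) (x : ℂ) => x) sqCt r Dt := by
  rintro ⟨hr, hfix, -⟩
  have h0 : ‖(0 : Unit → ℂ)‖ < r := by simpa using hr
  have hu := (hfix 0 h0).2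
  have e0 : (fun _ : Unit => (0 : ℂ)) = Dt 0 := hu _ (by
    change sqCt (0 - hOp id (fun (_ : Unit) (x : ℂ) => x) fun _ => (0 : ℂ)) = fun _ => 0
    funext u
    simp [sqCt, hOp_id_apply])
  have e1 : (fun _ : Unit => (1 : ℂ)) = Dt 0 := hu _ (by
    change sqCt (0 - hOp id (fun (_ : Unit) (x : ℂ) => x) fun _ => (1 : ℂ)) = fun _ => 1
    funext u
    simp [sqCt, hOp_id_apply])
  have h01 := congr_fun (e0.trans e1.symm) ()
  norm_num at h01

/-- … whereas the LOCAL statement holds for the same data (instance of `exists_eq17Local` with `C₂ = b = R = 1`,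
`ε = 1/10`: `9·(1/10) < 1`, `3/10 ≤ 1`). [cite: Balaban1985UV3, (17) pp.259–260] -/
theorem eq17Local_sqCt :
    ∃ Dt : (Unit → ℂ) → Unit → ℂ, Eq17Local ℂ id (fun (_ : Unit) (x : ℂ) => x) sqCt (1 / 10)
      (4 * 1 * (1 / 10) ^ 2) Dt := by
  have hh : ∀ (c : Unit) (x : ℂ), ‖(LinearMap.id : ℂ →ₗ[ℂ] ℂ) x‖ ≤ 1 * ‖x‖ := fun _ x => by simp
  have := exists_eq17Local (X := ℂ) id (fun _ : Unit => (LinearMap.id : ℂ →ₗ[ℂ] ℂ)) (quadAnalytic_sqCt 1)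
    (analyticOnNhd_sqCt _) zero_le_one zero_le_one hh (by norm_num : (0 : ℝ) < 1 / 10) (by norm_num) (by norm_num)
  simpa only [LinearMap.id_coe, Function.id_def] using this

end Refutation

/-! ## §4  Locality of the solution from LOCAL existence and uniqueness -/

section Locality

variable {β C X : Type*} [Fintype β] [Fintype C] [NormedAddCommGroup X]
  {b₀ : C → β} {h : C → X → X} {Ct : (β → X) → C → X} {N : C → Set β}

/-- **p. 260 «The function D̃(A, c), similarly as Q(A′, c), depends on A restricted to B(c₋) ∪ B(c₊)» from the LOCAL
solution theory**: if `(C̃ A)(c)` depends on `A` only on a bond set `N(c)` containing no foreign distinguished bond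
`b₀(c′)`, `c′ ≠ c`, and `Dt` is, on the ball `‖B‖ < r`, a solution of `D = C̃(B − hD)` of norm `≤ δ` that is unique
among solutions of norm `≤ δ` (the clauses of `Eq17Local`), then `Dt B c = Dt B′ c` whenever `B`, `B′` lie in the
ball and agree on `N(c)`.  (The cell's `B13PkLocalTerms.fixedPt_fpMap_apply_eq` is the same conclusion from GLOBAL
existence/uniqueness; proof here: patch the `c`-component of `Dt B′` by `Dt B c` — the patch is again a solution for
`B′` by locality and stays in the sup-norm `δ`-ball.) [cite: Balaban1985UV3, (17) p.260] -/
theorem fixedPt_fpMap_apply_eq_local [DecidableEq C] (hb : Function.Injective b₀)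
    (hsep : ∀ c c', c ≠ c' → b₀ c' ∉ N c) (hCt : ∀ A A' c, (∀ b ∈ N c, A b = A' b) → Ct A c = Ct A' c)
    {Dt : (β → X) → C → X} {r δ : ℝ}
    (hfix : ∀ B : β → X, ‖B‖ < r → Function.IsFixedPt (fpMap b₀ h Ct B) (Dt B))
    (hball : ∀ B : β → X, ‖B‖ < r → ‖Dt B‖ ≤ δ)
    (huniq : ∀ B : β → X, ‖B‖ < r → ∀ D : C → X, ‖D‖ ≤ δ → Function.IsFixedPt (fpMap b₀ h Ct B) D → D = Dt B)
    {B B' : β → X} (hB : ‖B‖ < r) (hB' : ‖B'‖ < r) {c : C} (hBB' : ∀ b ∈ N c, B b = B' b) :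
    Dt B c = Dt B' c := by
  have hT : IsLocalIn (fpMap b₀ h Ct) := isLocalIn_fpMap hb hsep hCt
  set D'' : C → X := Function.update (Dt B') c (Dt B c) with hD''
  have hδ : 0 ≤ δ := (norm_nonneg _).trans (hball B hB)
  -- the patched configuration solves the equation for `B'`
  have hfixD'' : Function.IsFixedPt (fpMap b₀ h Ct B') D'' := by
    change fpMap b₀ h Ct B' D'' = D''
    funext c'
    by_cases hc : c' = c
    · subst hc
      rw [apply_eq_localMap hT B' D'' c', hD'', Function.update_self,
        ← localMap_fpMap_eq_of_eqOn (b₀ := b₀) (h := h) hCt hBB', ← apply_eq_localMap hT B (Dt B) c']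
      exact congr_fun (hfix B hB) c'
    · rw [apply_eq_localMap hT B' D'' c', hD'', Function.update_of_ne hc, ← apply_eq_localMap hT B' (Dt B') c']
      exact congr_fun (hfix B' hB') c'
  -- and stays in the `δ`-ball (sup norm)
  have hnorm : ‖D''‖ ≤ δ := by
    refine (pi_norm_le_iff_of_nonneg hδ).2 fun c' => ?_
    by_cases hc : c' = c
    · subst hc
      rw [hD'', Function.update_self]
      exact (norm_le_pi_norm (Dt B) c').trans (hball B hB)
    · rw [hD'', Function.update_of_ne hc]
      exact (norm_le_pi_norm (Dt B') c').trans (hball B' hB')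
  have hEq := huniq B' hB' D'' hnorm hfixD''
  have := congr_fun hEq c
  rw [hD'', Function.update_self] at this
  exact this

/-- The same, fed directly by `Eq17Local`. [cite: Balaban1985UV3, (17) p.260] -/
theorem Eq17Local.apply_eq_of_eqOn {𝕜 : Type*} [NontriviallyNormedField 𝕜] [NormedSpace 𝕜 X] [DecidableEq C]
    {r δ : ℝ} {Dt : (β → X) → C → X} (h17 : Eq17Local 𝕜 b₀ h Ct r δ Dt) (hb : Function.Injective b₀)
    (hsep : ∀ c c', c ≠ c' → b₀ c' ∉ N c) (hCt : ∀ A A' c, (∀ b ∈ N c, A b = A' b) → Ct A c = Ct A' c)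
    {B B' : β → X} (hB : ‖B‖ < r) (hB' : ‖B'‖ < r) {c : C} (hBB' : ∀ b ∈ N c, B b = B' b) :
    Dt B c = Dt B' c :=
  fixedPt_fpMap_apply_eq_local hb hsep hCt (fun A hA => (h17.2.2.1 A hA).1) (fun A hA => (h17.2.2.1 A hA).2.1)
    (fun A hA => (h17.2.2.1 A hA).2.2) hB hB' hBB'

end Locality

/-! ## §5  (20) p. 261 for THE local solution: the block structure of the Jacobian from `Eq17Local` -/

section Eq20Local

variable {𝕜 : Type*} [NontriviallyNormedField 𝕜]

/-- **A Fréchet derivative kills every direction along which the function is LOCALLY constant** (the `∀ᶠ t`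
version of `B13PkLocalTerms.apply_eq_zero_of_forall_add_smul`). [folklore] -/
private theorem apply_eq_zero_of_eventually_add_smul {E F : Type*} [NormedAddCommGroup E] [NormedSpace 𝕜 E]
    [NormedAddCommGroup F] [NormedSpace 𝕜 F] {f : E → F} {x v : E} {L : E →L[𝕜] F} (hf : HasFDerivAt f L x)
    (hv : ∀ᶠ t : 𝕜 in 𝓝 0, f (x + t • v) = f x) : L v = 0 := by
  have h1 : HasLineDerivAt 𝕜 f (L v) x v := hf.hasLineDerivAt v
  have h2 : HasLineDerivAt 𝕜 f 0 x v := by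
    show HasDerivAt (fun t : 𝕜 => f (x + t • v)) 0 0
    exact (hasDerivAt_const (0 : 𝕜) (f x)).congr_of_eventuallyEq hv
  exact h1.unique h2

/-- Along any line through a point of the open ball one stays in the ball for small parameters. [folklore] -/
private theorem eventually_norm_add_smul_lt {E : Type*} [NormedAddCommGroup E] [NormedSpace 𝕜 E] {A : E} (v : E)
    {r : ℝ} (hA : ‖A‖ < r) : ∀ᶠ t : 𝕜 in 𝓝 0, ‖A + t • v‖ < r := by
  have hc : Continuous fun t : 𝕜 => ‖A + t • v‖ :=
    (continuous_const.add (continuous_id.smul continuous_const)).norm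
  exact (isOpen_lt hc continuous_const).mem_nhds (by simpa using hA)

variable {β C ι : Type*} [Fintype β] [DecidableEq β] [Fintype C] [DecidableEq C] [Fintype ι] [DecidableEq ι]
  {b₀ : C → β} {h : C → (ι → 𝕜) → (ι → 𝕜)} {Ct : (β → ι → 𝕜) → C → (ι → 𝕜)} {N : C → Set β}
  {Dt : (β → ι → 𝕜) → C → (ι → 𝕜)} {r δ : ℝ}

/-- **(20) p. 261 for THE local solution of (17)**: with `X = ι → 𝕜` (coordinates of `𝔤`), if `Dt` is on the ball
`‖A‖ < r` the locally unique solution of `D = C̃(A − hD)` (clauses of `Eq17Local`), `C̃(·)(c)` depends on `A↾N(c)`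
with `b₀(c′) ∉ N(c)` for `c′ ≠ c`, and `L` is a Fréchet derivative of `A ↦ hD̃(A)` at a point `A` of the ball, then
`det(I − L) = Π_c det(1 − J_c)`, `J_c` the `ι × ι` block of `L` at `b₀(c)` — verbatim print: *«exp Tr log(I −
(δ/δA)D̃(A)) = exp[Σ_{c∈Ω₁^{(1)}} tr log(1 − (∂/∂A(b₀(c)))D̃(A, b₀(c), c))]»*.  The cell's
`B10Eq20Locality.eq20_of_fixedPt` is the same conclusion from GLOBAL existence/uniqueness of the fixed point for
every `A`; here the zero coarse off-diagonal blocks come from `fixedPt_fpMap_apply_eq_local` along the line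
`A + t·δ_{b₀ c′}`, `t` small (`apply_eq_zero_of_eventually_add_smul`), and the zero rows off `range b₀` from the
support of `hOp` (`B10Eq20Locality.isSupportedOn_hOp`); the determinant identity is the cell's
`B10Eq20Locality.det_one_sub_eq_prod` by name. [cite: Balaban1985UV3, (20) p.261] -/
theorem eq20_of_local (hb : Function.Injective b₀) (hsep : ∀ c c', c ≠ c' → b₀ c' ∉ N c)
    (hCt : ∀ A A' c, (∀ b ∈ N c, A b = A' b) → Ct A c = Ct A' c)
    (hfix : ∀ B : β → ι → 𝕜, ‖B‖ < r → Function.IsFixedPt (fpMap b₀ h Ct B) (Dt B))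
    (hball : ∀ B : β → ι → 𝕜, ‖B‖ < r → ‖Dt B‖ ≤ δ)
    (huniq : ∀ B : β → ι → 𝕜, ‖B‖ < r → ∀ D : C → ι → 𝕜, ‖D‖ ≤ δ →
      Function.IsFixedPt (fpMap b₀ h Ct B) D → D = Dt B)
    {A : β → ι → 𝕜} (hA : ‖A‖ < r) {L : (β → ι → 𝕜) →L[𝕜] (β → ι → 𝕜)}
    (hL : HasFDerivAt (fun A => hOp b₀ h (Dt A)) L A) :
    LinearMap.det (LinearMap.id - (L : (β → ι → 𝕜) →ₗ[𝕜] (β → ι → 𝕜)))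
      = ∏ c, (1 - B10Eq20Locality.coarseBlock b₀
          (B10Eq20Locality.jac (L : (β → ι → 𝕜) →ₗ[𝕜] (β → ι → 𝕜))) c).det := by
  rw [B10Eq20Locality.det_id_sub_eq]
  refine B10Eq20Locality.det_one_sub_eq_prod b₀ hb _ (fun p q hp => ?_) (fun c c' i j hcc' => ?_)
  · have h0 := B10Eq20Locality.apply_eq_zero_of_isSupportedOn (B10Eq20Locality.isSupportedOn_hOp Dt) hL hp
      (Pi.single q.1 (Pi.single q.2 1))
    simp only [B10Eq20Locality.jac_apply, ContinuousLinearMap.coe_coe, h0, Pi.zero_apply]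
  · obtain ⟨v, hv⟩ : ∃ v : β → ι → 𝕜, v = Pi.single (b₀ c') (Pi.single j 1) := ⟨_, rfl⟩
    have h1 : HasFDerivAt (fun A => hOp b₀ h (Dt A) (b₀ c)) ((ContinuousLinearMap.proj (b₀ c)).comp L) A :=
      (hasFDerivAt_pi'.1 hL) (b₀ c)
    have hev : ∀ᶠ t : 𝕜 in 𝓝 0, hOp b₀ h (Dt (A + t • v)) (b₀ c) = hOp b₀ h (Dt A) (b₀ c) := by
      filter_upwards [eventually_norm_add_smul_lt v hA] with t ht
      have hDt : Dt (A + t • v) c = Dt A c :=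
        fixedPt_fpMap_apply_eq_local hb hsep hCt hfix hball huniq ht hA fun b hbN => by
          have hne : b ≠ b₀ c' := fun hEq => hsep c c' hcc' (hEq ▸ hbN)
          simp only [hv, Pi.add_apply, Pi.smul_apply, Pi.single_eq_of_ne hne, smul_zero, add_zero]
      rw [hOp_apply_b₀ hb, hOp_apply_b₀ hb, hDt]
    have h0 := apply_eq_zero_of_eventually_add_smul h1 hev
    have h0' : L (Pi.single (b₀ c') (Pi.single j (1 : 𝕜))) (b₀ c) = 0 := by
      rw [← hv]; simpa using h0
    simp only [B10Eq20Locality.jac_apply, ContinuousLinearMap.coe_coe, h0', Pi.zero_apply]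

/-- **(20) fed by `Eq17Local`** (the print-faithful (17) ⇒ the block Jacobian of (20), with the locality of `C̃`).
[cite: Balaban1985UV3, (20) p.261] -/
theorem Eq17Local.eq20 {r δ : ℝ} {Dt : (β → ι → 𝕜) → C → (ι → 𝕜)}
    (h17 : Eq17Local 𝕜 b₀ h Ct r δ Dt) (hb : Function.Injective b₀)
    (hsep : ∀ c c', c ≠ c' → b₀ c' ∉ N c) (hCt : ∀ A A' c, (∀ b ∈ N c, A b = A' b) → Ct A c = Ct A' c)
    {A : β → ι → 𝕜} (hA : ‖A‖ < r) {L : (β → ι → 𝕜) →L[𝕜] (β → ι → 𝕜)}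
    (hL : HasFDerivAt (fun A => hOp b₀ h (Dt A)) L A) :
    LinearMap.det (LinearMap.id - (L : (β → ι → 𝕜) →ₗ[𝕜] (β → ι → 𝕜)))
      = ∏ c, (1 - B10Eq20Locality.coarseBlock b₀
          (B10Eq20Locality.jac (L : (β → ι → 𝕜) →ₗ[𝕜] (β → ι → 𝕜))) c).det :=
  eq20_of_local hb hsep hCt (fun B hB => (h17.2.2.1 B hB).1) (fun B hB => (h17.2.2.1 B hB).2.1)
    (fun B hB => (h17.2.2.1 B hB).2.2) hA hL

/-- **(20) as printed, inside `exp`, over `ℂ`** for the local solution: `det(I − (δ/δA)hD̃(A)) =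
exp[Σ_c log det(1 − J_c)]` whenever every block determinant is non-zero
(`B13PkLocalTerms.exp_sum_log_det_eq_prod`). [cite: Balaban1985UV3, (20) p.261] -/
theorem Eq17Local.eq20_exp_sum_log {β C ι : Type*} [Fintype β] [DecidableEq β] [Fintype C] [DecidableEq C]
    [Fintype ι] [DecidableEq ι] {b₀ : C → β} {h : C → (ι → ℂ) → (ι → ℂ)} {Ct : (β → ι → ℂ) → C → (ι → ℂ)}
    {N : C → Set β} {r δ : ℝ} {Dt : (β → ι → ℂ) → C → (ι → ℂ)}
    (h17 : Eq17Local ℂ b₀ h Ct r δ Dt) (hb : Function.Injective b₀)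
    (hsep : ∀ c c', c ≠ c' → b₀ c' ∉ N c) (hCt : ∀ A A' c, (∀ b ∈ N c, A b = A' b) → Ct A c = Ct A' c)
    {A : β → ι → ℂ} (hA : ‖A‖ < r) {L : (β → ι → ℂ) →L[ℂ] (β → ι → ℂ)}
    (hL : HasFDerivAt (fun A => hOp b₀ h (Dt A)) L A)
    (hJ : ∀ c, (1 - B10Eq20Locality.coarseBlock b₀
      (B10Eq20Locality.jac (L : (β → ι → ℂ) →ₗ[ℂ] (β → ι → ℂ))) c).det ≠ 0) :
    LinearMap.det (LinearMap.id - (L : (β → ι → ℂ) →ₗ[ℂ] (β → ι → ℂ)))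
      = Complex.exp (∑ c, Complex.log (1 - B10Eq20Locality.coarseBlock b₀
          (B10Eq20Locality.jac (L : (β → ι → ℂ) →ₗ[ℂ] (β → ι → ℂ))) c).det) := by
  rw [h17.eq20 hb hsep hCt hA hL, B13PkLocalTerms.exp_sum_log_det_eq_prod Finset.univ _ fun c _ => hJ c]

end Eq20Local

/-! ## §6  Real scalars (v1.1): (17) from «C analytic near 0 with a Taylor expansion beginning with second order
terms» directly — Banach's fixed point theorem in a closed ball + the real-analytic implicit function theorem -/

section Real

variable {X : Type*} [NormedAddCommGroup X] [NormedSpace ℝ X] [CompleteSpace X]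
  {β C : Type*} [Fintype β] [Fintype C]

/-- Neumann series: `‖A‖ < 1 ⇒ id + A` is invertible on a real Banach space (`Units.oneSub`). [folklore] -/
private theorem isInvertible_id_add_real {E : Type*} [NormedAddCommGroup E] [NormedSpace ℝ E] [CompleteSpace E]
    {A : E →L[ℝ] E} (hA : ‖A‖ < 1) : (ContinuousLinearMap.id ℝ E + A).IsInvertible := by
  have hA1 : ‖-A‖ < 1 := by rwa [norm_neg]
  set U := Units.oneSub (-A) hA1 with hU
  have hUval : (U : E →L[ℝ] E) = ContinuousLinearMap.id ℝ E + A := by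
    rw [hU, Units.val_oneSub, sub_neg_eq_add, ContinuousLinearMap.one_def]
  have hf : (ContinuousLinearMap.id ℝ E + A) ∘L (↑U⁻¹ : E →L[ℝ] E) = ContinuousLinearMap.id ℝ E := by
    rw [← hUval, ← ContinuousLinearMap.mul_def, Units.mul_inv, ContinuousLinearMap.one_def]
  have hg : (↑U⁻¹ : E →L[ℝ] E) ∘L (ContinuousLinearMap.id ℝ E + A) = ContinuousLinearMap.id ℝ E := by
    rw [← hUval, ← ContinuousLinearMap.mul_def, Units.inv_mul, ContinuousLinearMap.one_def]
  exact ContinuousLinearMap.IsInvertible.of_inverse hf hg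

omit [CompleteSpace X] in
/-- From «analytic near 0 with DC(0) = 0»: a radius `ρ ≤ R` on which `‖DC̃‖ ≤ κ`, for any `κ > 0`
(continuity of the derivative of a `C^ω` map on the open ball). [folklore] -/
private theorem exists_radius_norm_fderiv_le {Ct : (β → X) → C → X} {R κ : ℝ} (hR : 0 < R)
    (hCω : ContDiffOn ℝ ω Ct (ball 0 R)) (hDC0 : fderiv ℝ Ct 0 = 0) (hκ : 0 < κ) :
    ∃ ρ : ℝ, 0 < ρ ∧ ρ ≤ R ∧ ∀ Y : β → X, ‖Y‖ < ρ → ‖fderiv ℝ Ct Y‖ ≤ κ := by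
  have hcont : ContinuousOn (fderiv ℝ Ct) (ball (0 : β → X) R) :=
    hCω.continuousOn_fderiv_of_isOpen isOpen_ball le_top
  have hca : ContinuousAt (fderiv ℝ Ct) 0 := hcont.continuousAt (isOpen_ball.mem_nhds (mem_ball_self hR))
  rw [Metric.continuousAt_iff] at hca
  obtain ⟨ρ₀, hρ₀, hρ₀'⟩ := hca κ hκ
  refine ⟨min ρ₀ R, lt_min hρ₀ hR, min_le_right _ _, fun Y hY => ?_⟩
  have h1 : dist Y 0 < ρ₀ := by rw [dist_zero_right]; exact hY.trans_le (min_le_left _ _)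
  have h2 := hρ₀' h1
  rw [hDC0, dist_zero_right] at h2
  exact h2.le

omit [CompleteSpace X] in
/-- Mean-value Lipschitz bound for `C̃` on the ball `‖Y‖ < ρ ≤ R` from `‖DC̃‖ ≤ κ` there. [folklore] -/
private theorem norm_sub_le_of_fderiv_le {Ct : (β → X) → C → X} {R ρ κ : ℝ}
    (hCω : ContDiffOn ℝ ω Ct (ball 0 R)) (hρR : ρ ≤ R) (hκ : ∀ Y : β → X, ‖Y‖ < ρ → ‖fderiv ℝ Ct Y‖ ≤ κ)
    {Y₁ Y₂ : β → X} (h₁ : ‖Y₁‖ < ρ) (h₂ : ‖Y₂‖ < ρ) : ‖Ct Y₁ - Ct Y₂‖ ≤ κ * ‖Y₁ - Y₂‖ := by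
  have hdiff : ∀ Y ∈ ball (0 : β → X) ρ, DifferentiableAt ℝ Ct Y := fun Y hY =>
    (hCω.differentiableOn (by simp)).differentiableAt (isOpen_ball.mem_nhds (ball_subset_ball hρR hY))
  have hbd : ∀ Y ∈ ball (0 : β → X) ρ, ‖fderiv ℝ Ct Y‖ ≤ κ := fun Y hY => hκ Y (mem_ball_zero_iff.mp hY)
  exact (convex_ball (0 : β → X) ρ).norm_image_sub_le_of_norm_fderiv_le hdiff hbd
    (mem_ball_zero_iff.mpr h₂) (mem_ball_zero_iff.mpr h₁)

/-- **(17) over the reals, core**: explicit-radius form.  If `C̃` is `C^ω` on `‖Y‖ < R`, `C̃(0) = 0`, `‖DC̃‖ ≤ κ`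
on `‖Y‖ < ρ ≤ R`, `h` linear with `‖h c x‖ ≤ b‖x‖`, `κb < 1`, and the radii `r > 0`, `δ ≥ 0` satisfy
`r + bδ ≤ ρ` (arguments stay in the ball) and `κ(r + bδ) ≤ δ` (self-map), then `Eq17Local ℝ b₀ h C̃ r δ Dt` holds for
some `Dt` (and `DDt(0) = 0` uses `DC̃(0) = 0`).  Proof: Banach's theorem in the closed ball `δ`
(`B8SectDSource.fixedPoint_closedBall`), Lipschitz dependence on `A`, Mathlib's `C^ω` implicit function theorem
(`ContDiffAt.implicitFunction`, `n = ω`, scalars `ℝ`) identified with the fixed point by local uniqueness.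
[cite: Balaban1985UV3, (17) pp.259–260] -/
theorem exists_eq17Local_real_core (b₀ : C → β) (h : C → X →ₗ[ℝ] X) {Ct : (β → X) → C → X}
    {R ρ κ b r δ : ℝ} (hCω : ContDiffOn ℝ ω Ct (ball 0 R)) (hC0 : Ct 0 = 0) (hDC0 : fderiv ℝ Ct 0 = 0)
    (hρR : ρ ≤ R) (hκ0 : 0 ≤ κ) (hκ : ∀ Y : β → X, ‖Y‖ < ρ → ‖fderiv ℝ Ct Y‖ ≤ κ)
    (hb : 0 ≤ b) (hh : ∀ c x, ‖h c x‖ ≤ b * ‖x‖) (hκb : κ * b < 1)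
    (hr : 0 < r) (hδ : 0 ≤ δ) (hrad : r + b * δ ≤ ρ) (hself : κ * (r + b * δ) ≤ δ) :
    ∃ Dt : (β → X) → (C → X), Eq17Local ℝ b₀ (fun c => ⇑(h c)) Ct r δ Dt := by
  have hHop : ∀ D : C → X, ‖hOpLin b₀ h D‖ ≤ b * ‖D‖ := norm_hOpLin_le b₀ h hb hh
  set hL : (C → X) →L[ℝ] (β → X) := (hOpLin b₀ h).mkContinuous b hHop with hLdef
  have hL_apply : ∀ D, hL D = hOpLin b₀ h D := fun D => by simp [hLdef]
  -- arguments stay in the ball `ρ`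
  have harg : ∀ {A : β → X} {D : C → X}, ‖A‖ < r → ‖D‖ ≤ δ → ‖A - hOpLin b₀ h D‖ < ρ := by
    intro A D hA hD
    calc ‖A - hOpLin b₀ h D‖ ≤ ‖A‖ + ‖hOpLin b₀ h D‖ := norm_sub_le _ _
      _ < r + b * δ := add_lt_add_of_lt_of_le hA ((hHop D).trans (mul_le_mul_of_nonneg_left hD hb))
      _ ≤ ρ := hrad
  have hC_le : ∀ {Y : β → X}, ‖Y‖ < ρ → ‖Ct Y‖ ≤ κ * ‖Y‖ := by
    intro Y hY
    have hρ : 0 < ρ := (norm_nonneg Y).trans_lt hY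
    have := norm_sub_le_of_fderiv_le hCω hρR hκ (Y₂ := 0) hY (by simpa using hρ)
    simpa [hC0] using this
  -- Banach in the closed ball, for each `A` in the ball
  have hfp : ∀ A : β → X, ‖A‖ < r →
      ∃! D : C → X, ‖D‖ ≤ δ ∧ Ct (A - hOpLin b₀ h D) = D := by
    intro A hA
    refine B8SectDSource.fixedPoint_closedBall (fun D => Ct (A - hOpLin b₀ h D)) hδ (by positivity) hκb
      (fun D hD => ?_) (fun D₁ D₂ hD₁ hD₂ => ?_)
    · have hle : ‖A - hOpLin b₀ h D‖ ≤ r + b * δ :=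
        calc ‖A - hOpLin b₀ h D‖ ≤ ‖A‖ + ‖hOpLin b₀ h D‖ := norm_sub_le _ _
          _ ≤ r + b * δ := add_le_add hA.le ((hHop D).trans (mul_le_mul_of_nonneg_left hD hb))
      calc ‖Ct (A - hOpLin b₀ h D)‖ ≤ κ * ‖A - hOpLin b₀ h D‖ := hC_le (harg hA hD)
        _ ≤ κ * (r + b * δ) := mul_le_mul_of_nonneg_left hle hκ0
        _ ≤ δ := hself
    · calc ‖Ct (A - hOpLin b₀ h D₁) - Ct (A - hOpLin b₀ h D₂)‖
            ≤ κ * ‖(A - hOpLin b₀ h D₁) - (A - hOpLin b₀ h D₂)‖ :=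
              norm_sub_le_of_fderiv_le hCω hρR hκ (harg hA hD₁) (harg hA hD₂)
        _ = κ * ‖hOpLin b₀ h (D₂ - D₁)‖ := by rw [sub_sub_sub_cancel_left, ← map_sub]
        _ ≤ κ * (b * ‖D₂ - D₁‖) := mul_le_mul_of_nonneg_left (hHop _) hκ0
        _ = κ * b * ‖D₁ - D₂‖ := by rw [norm_sub_rev]; ring
  choose! Dt hDt using fun A (hA : ‖A‖ < r) => (hfp A hA).exists
  have hball : ∀ A, ‖A‖ < r → ‖Dt A‖ ≤ δ := fun A hA => (hDt A hA).1
  have hfix : ∀ A, ‖A‖ < r → Ct (A - hOpLin b₀ h (Dt A)) = Dt A := fun A hA => (hDt A hA).2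
  have huniq : ∀ A, ‖A‖ < r → ∀ D, ‖D‖ ≤ δ → Ct (A - hOpLin b₀ h D) = D → D = Dt A :=
    fun A hA D hD hDfix => (hfp A hA).unique ⟨hD, hDfix⟩ (hDt A hA)
  have h0r : ‖(0 : β → X)‖ < r := by simpa using hr
  have hDt0 : Dt 0 = 0 := (huniq 0 h0r 0 (by simpa using hδ) (by simp [hC0])).symm
  -- Lipschitz dependence on `A`
  have hlipDt : ∀ {A₁ A₂ : β → X}, ‖A₁‖ < r → ‖A₂‖ < r →
      ‖Dt A₁ - Dt A₂‖ ≤ κ / (1 - κ * b) * ‖A₁ - A₂‖ := by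
    intro A₁ A₂ h₁ h₂
    have hkey : ‖Dt A₁ - Dt A₂‖ ≤ κ * (‖A₁ - A₂‖ + b * ‖Dt A₁ - Dt A₂‖) := by
      calc ‖Dt A₁ - Dt A₂‖ = ‖Ct (A₁ - hOpLin b₀ h (Dt A₁)) - Ct (A₂ - hOpLin b₀ h (Dt A₂))‖ := by
            rw [hfix A₁ h₁, hfix A₂ h₂]
        _ ≤ κ * ‖(A₁ - hOpLin b₀ h (Dt A₁)) - (A₂ - hOpLin b₀ h (Dt A₂))‖ :=
            norm_sub_le_of_fderiv_le hCω hρR hκ (harg h₁ (hball A₁ h₁)) (harg h₂ (hball A₂ h₂))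
        _ = κ * ‖(A₁ - A₂) - hOpLin b₀ h (Dt A₁ - Dt A₂)‖ := by congr 2; rw [map_sub]; abel
        _ ≤ κ * (‖A₁ - A₂‖ + ‖hOpLin b₀ h (Dt A₁ - Dt A₂)‖) :=
            mul_le_mul_of_nonneg_left (norm_sub_le _ _) hκ0
        _ ≤ κ * (‖A₁ - A₂‖ + b * ‖Dt A₁ - Dt A₂‖) :=
            mul_le_mul_of_nonneg_left (by linarith [hHop (Dt A₁ - Dt A₂)]) hκ0
    have h1q : 0 < 1 - κ * b := sub_pos.mpr hκb
    rw [div_mul_eq_mul_div, le_div_iff₀ h1q]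
    nlinarith [hkey, norm_nonneg (Dt A₁ - Dt A₂), norm_nonneg (A₁ - A₂), mul_nonneg hκ0 hb]
  have hcontDt : ∀ {A₀ : β → X}, ‖A₀‖ < r → ContinuousAt Dt A₀ := by
    intro A₀ hA₀
    set K : ℝ := κ / (1 - κ * b) with hK
    have hK0 : 0 ≤ K := div_nonneg hκ0 (sub_pos.mpr hκb).le
    rw [Metric.continuousAt_iff]
    intro η hη
    have hgap : 0 < r - ‖A₀‖ := sub_pos.mpr hA₀
    refine ⟨min (r - ‖A₀‖) (η / (K + 1)), lt_min hgap (by positivity), fun A hA => ?_⟩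
    rw [dist_eq_norm] at hA ⊢
    have hAr : ‖A‖ < r := by
      calc ‖A‖ = ‖(A - A₀) + A₀‖ := by rw [sub_add_cancel]
        _ ≤ ‖A - A₀‖ + ‖A₀‖ := norm_add_le _ _
        _ < (r - ‖A₀‖) + ‖A₀‖ := by linarith [lt_of_lt_of_le hA (min_le_left _ _)]
        _ = r := by ring
    calc ‖Dt A - Dt A₀‖ ≤ K * ‖A - A₀‖ := hlipDt hAr hA₀
      _ ≤ K * (η / (K + 1)) := by gcongr; exact (lt_of_lt_of_le hA (min_le_right _ _)).le
      _ < (K + 1) * (η / (K + 1)) := by gcongr; linarith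
      _ = η := by field_simp
  -- the implicit function theorem at each point of the ball
  have hIFT : ∀ {A₀ : β → X}, ‖A₀‖ < r →
      AnalyticAt ℝ Dt A₀ ∧ (A₀ = 0 → HasFDerivAt Dt (0 : (β → X) →L[ℝ] (C → X)) A₀) := by
    intro A₀ hA₀
    have hω : (ω : ℕ∞ω) ≠ 0 := by simp
    have hY₀ : ‖A₀ - hOpLin b₀ h (Dt A₀)‖ < ρ := harg hA₀ (hball A₀ hA₀)
    have hY₀R : A₀ - hOpLin b₀ h (Dt A₀) ∈ ball (0 : β → X) R :=
      mem_ball_zero_iff.mpr (hY₀.trans_le hρR)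
    set F : (β → X) × (C → X) → (C → X) := fun p => p.2 - Ct (p.1 - hL p.2) with hF
    set lin : (β → X) × (C → X) →L[ℝ] (β → X) :=
      ContinuousLinearMap.fst ℝ (β → X) (C → X) - hL ∘L ContinuousLinearMap.snd ℝ (β → X) (C → X) with hlin
    have hlin_apply : ∀ p : (β → X) × (C → X), lin p = p.1 - hOpLin b₀ h p.2 := fun p => by
      simp [hlin, hL_apply]
    have hFeq : F = fun p => (ContinuousLinearMap.snd ℝ (β → X) (C → X)) p - (Ct ∘ ⇑lin) p := by
      funext p; simp [hF, hlin_apply, hL_apply]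
    have hCat : ContDiffAt ℝ ω Ct (lin (A₀, Dt A₀)) := by
      rw [hlin_apply]; exact hCω.contDiffAt (isOpen_ball.mem_nhds hY₀R)
    have hFω : ContDiffAt ℝ ω F (A₀, Dt A₀) := by
      rw [hFeq]
      exact contDiffAt_snd.sub (hCat.comp _ lin.contDiff.contDiffAt)
    have hFd : fderiv ℝ F (A₀, Dt A₀) = ContinuousLinearMap.snd ℝ (β → X) (C → X) -
        (fderiv ℝ Ct (A₀ - hOpLin b₀ h (Dt A₀))) ∘L lin := by
      have hC : HasFDerivAt Ct (fderiv ℝ Ct (A₀ - hOpLin b₀ h (Dt A₀))) (lin (A₀, Dt A₀)) := by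
        rw [hlin_apply]; exact (hCat.differentiableAt hω).hasFDerivAt
      have hFD := (ContinuousLinearMap.snd ℝ (β → X) (C → X)).hasFDerivAt.sub
        (hC.comp (A₀, Dt A₀) lin.hasFDerivAt)
      rw [hFeq]; exact hFD.fderiv
    have hsnd : (ContinuousLinearMap.snd ℝ (β → X) (C → X) -
        (fderiv ℝ Ct (A₀ - hOpLin b₀ h (Dt A₀))) ∘L lin) ∘L ContinuousLinearMap.inr ℝ (β → X) (C → X) =
        ContinuousLinearMap.id ℝ (C → X) + fderiv ℝ Ct (A₀ - hOpLin b₀ h (Dt A₀)) ∘L hL := by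
      ext D; simp [hlin]
    have hsmall : ‖fderiv ℝ Ct (A₀ - hOpLin b₀ h (Dt A₀)) ∘L hL‖ < 1 := by
      calc ‖fderiv ℝ Ct (A₀ - hOpLin b₀ h (Dt A₀)) ∘L hL‖
            ≤ ‖fderiv ℝ Ct (A₀ - hOpLin b₀ h (Dt A₀))‖ * ‖hL‖ := ContinuousLinearMap.opNorm_comp_le _ _
        _ ≤ κ * b := mul_le_mul (hκ _ hY₀) (LinearMap.mkContinuous_norm_le _ hb _) (norm_nonneg _) hκ0
        _ < 1 := hκb
    have hinr : (fderiv ℝ F (A₀, Dt A₀) ∘L ContinuousLinearMap.inr ℝ (β → X) (C → X)).IsInvertible := by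
      rw [hFd, hsnd]; exact isInvertible_id_add_real hsmall
    have heq : hFω.implicitFunction hω hinr =ᶠ[𝓝 A₀] Dt := by
      have hψ := hFω.eventually_apply_eq_iff_implicitFunction hω hinr
      have ht : ContinuousAt (fun A : β → X => (A, Dt A)) A₀ := continuousAt_id.prodMk (hcontDt hA₀)
      have h1 : ∀ᶠ A in 𝓝 A₀, F (A, Dt A) = F (A₀, Dt A₀) ↔
          hFω.implicitFunction hω hinr (A, Dt A).1 = (A, Dt A).2 := Filter.Tendsto.eventually ht hψ
      have hballA : ∀ᶠ A in 𝓝 A₀, ‖A‖ < r := (isOpen_lt continuous_norm continuous_const).mem_nhds hA₀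
      filter_upwards [h1, hballA] with A h hAr
      refine h.1 ?_
      show Dt A - Ct (A - hL (Dt A)) = Dt A₀ - Ct (A₀ - hL (Dt A₀))
      rw [hL_apply, hL_apply, hfix A hAr, hfix A₀ hA₀, sub_self, sub_self]
    refine ⟨((hFω.contDiffAt_implicitFunction hω hinr).analyticAt).congr heq, fun hA00 => ?_⟩
    subst hA00
    have hψd := (hFω.hasStrictFDerivAt_implicitFunction hω hinr).congr_of_eventuallyEq heq
    refine (hψd.hasFDerivAt).congr_fderiv ?_
    have hD0 : fderiv ℝ Ct ((0 : β → X) - hOpLin b₀ h (Dt 0)) = 0 := by rw [hDt0, map_zero, sub_zero, hDC0]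
    rw [hFd, hD0]
    ext A c
    simp
  refine ⟨Dt, hr, hδ, fun A hA => ⟨?_, hball A hA, fun D hD hfixD => ?_⟩, ?_, hDt0, (hIFT h0r).2 rfl⟩
  · change Ct (A - hOpLin b₀ h (Dt A)) = Dt A
    exact hfix A hA
  · change Ct (A - hOpLin b₀ h D) = D at hfixD
    exact huniq A hA D hD hfixD
  · intro A hA
    exact ((hIFT (mem_ball_zero_iff.mp hA)).1).analyticWithinAt

/-- **(17) over the reals, as printed**: if `C̃` is real-analytic (`C^ω`) on a ball `‖Y‖ < R` around `0` with
`C̃(0) = 0` and `DC̃(0) = 0` («a Taylor expansion beginning with second order terms» for the data, as for print's `C` of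
(15)), and `h(c)` are linear with `‖h c x‖ ≤ b‖x‖`, then for some radii `r > 0`, `δ > 0` and some `Dt` the local
statement `Eq17Local ℝ b₀ h C̃ r δ Dt` holds: «There exists a unique solution D̃ of this equation for A sufficiently
small, and it is an analytic function of A with a Taylor expansion beginning with second order terms.»  Radii: with
`κ = (2(b+1))⁻¹` and `ρ ≤ R` such that `‖DC̃‖ ≤ κ` on `‖Y‖ < ρ` (continuity of `DC̃` at `0`), `r = ρ/4`,
`δ = ρ/(4(b+1))`. [cite: Balaban1985UV3, (17) pp.259–260] -/
theorem exists_eq17Local_real (b₀ : C → β) (h : C → X →ₗ[ℝ] X) {Ct : (β → X) → C → X} {R b : ℝ}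
    (hR : 0 < R) (hCω : ContDiffOn ℝ ω Ct (ball 0 R)) (hC0 : Ct 0 = 0) (hDC0 : fderiv ℝ Ct 0 = 0)
    (hb : 0 ≤ b) (hh : ∀ c x, ‖h c x‖ ≤ b * ‖x‖) :
    ∃ r δ : ℝ, 0 < δ ∧ ∃ Dt : (β → X) → (C → X), Eq17Local ℝ b₀ (fun c => ⇑(h c)) Ct r δ Dt := by
  have hb1 : 0 < b + 1 := by linarith
  set κ : ℝ := 1 / 2 / (b + 1) with hκdef
  have hκ0 : 0 < κ := by positivity
  obtain ⟨ρ, hρ, hρR, hκ⟩ := exists_radius_norm_fderiv_le hR hCω hDC0 hκ0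
  set r : ℝ := ρ / 4 with hrdef
  set δ : ℝ := ρ / 4 / (b + 1) with hδdef
  have hr : 0 < r := by positivity
  have hδ : 0 < δ := by positivity
  have h1 : b / (b + 1) ≤ 1 := (div_le_one hb1).mpr (by linarith)
  have hκb : κ * b < 1 := by
    have : κ * b = b / (b + 1) / 2 := by rw [hκdef]; ring
    rw [this]; linarith
  have hbδ : b * δ ≤ ρ / 4 := by
    calc b * δ = b / (b + 1) * (ρ / 4) := by rw [hδdef]; ring
      _ ≤ 1 * (ρ / 4) := mul_le_mul_of_nonneg_right h1 (by positivity)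
      _ = ρ / 4 := one_mul _
  have hrad : r + b * δ ≤ ρ := by rw [hrdef]; linarith
  have hself : κ * (r + b * δ) ≤ δ := by
    calc κ * (r + b * δ) ≤ κ * (ρ / 2) := mul_le_mul_of_nonneg_left (by rw [hrdef]; linarith) hκ0.le
      _ = δ := by rw [hκdef, hδdef]; ring
  exact ⟨r, δ, hδ, exists_eq17Local_real_core b₀ h hCω hC0 hDC0 hρR hκ0.le hκ hb hh hκb hr hδ.le hrad hself⟩

end Real

/-! ## §7  Real scalars (v1.2): uniqueness in print's OWN solution space — [7] p. 286 «there exists exactly one fixed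
point of the transformation (50) … It satisfies the bound |D(A′)| < ε₃/B₀» — for the real local solution of §6 (the
ℝ mirror of the last clause of `exists_solution`) -/

section RealUnique

variable {X : Type*} [NormedAddCommGroup X] [NormedSpace ℝ X] [CompleteSpace X]
  {β C : Type*} [Fintype β] [Fintype C]

omit [CompleteSpace X] in
/-- **Two solutions of (17) whose arguments `A − hD` lie in the ball where `C̃` contracts coincide** (real scalars):
if `C̃` is `C^ω` on `‖Y‖ < R` with `‖DC̃‖ ≤ κ` on `‖Y‖ < ρ ≤ R`, `‖h c x‖ ≤ b‖x‖` and `κb < 1`, then any two fixed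
points `D₁`, `D₂` of `D ↦ C̃(A − hD)` (`B13PkLocalTerms.fpMap`) with `‖A − hD₁‖, ‖A − hD₂‖ < ρ` are equal — the
mean-value Lipschitz bound gives `‖D₁ − D₂‖ ≤ κb‖D₁ − D₂‖`.  This is the contraction step of [7] Sect. C p. 286
((54): «9C₂B₀ε₃ ≦ ½») in the real setting; no smallness of `‖D_i‖` themselves is assumed. [cite: Balaban1985UV3, (17) pp.259–260] -/
theorem eq_of_isFixedPt_of_fderiv_le (b₀ : C → β) (h : C → X →ₗ[ℝ] X) {Ct : (β → X) → C → X}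
    {R ρ κ b : ℝ} (hCω : ContDiffOn ℝ ω Ct (ball 0 R)) (hρR : ρ ≤ R) (hκ0 : 0 ≤ κ)
    (hκ : ∀ Y : β → X, ‖Y‖ < ρ → ‖fderiv ℝ Ct Y‖ ≤ κ) (hb : 0 ≤ b) (hh : ∀ c x, ‖h c x‖ ≤ b * ‖x‖)
    (hκb : κ * b < 1) {A : β → X} {D₁ D₂ : C → X}
    (h₁ : ‖A - hOpLin b₀ h D₁‖ < ρ) (h₂ : ‖A - hOpLin b₀ h D₂‖ < ρ)
    (hfix₁ : Function.IsFixedPt (fpMap b₀ (fun c => ⇑(h c)) Ct A) D₁)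
    (hfix₂ : Function.IsFixedPt (fpMap b₀ (fun c => ⇑(h c)) Ct A) D₂) : D₁ = D₂ := by
  have hHop : ∀ D : C → X, ‖hOpLin b₀ h D‖ ≤ b * ‖D‖ := norm_hOpLin_le b₀ h hb hh
  change Ct (A - hOpLin b₀ h D₁) = D₁ at hfix₁
  change Ct (A - hOpLin b₀ h D₂) = D₂ at hfix₂
  have hlip := norm_sub_le_of_fderiv_le hCω hρR hκ h₁ h₂
  rw [hfix₁, hfix₂, sub_sub_sub_cancel_left, ← map_sub] at hlip
  have h2 : ‖hOpLin b₀ h (D₂ - D₁)‖ ≤ b * ‖D₁ - D₂‖ := (hHop _).trans_eq (by rw [norm_sub_rev])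
  have h3 : ‖D₁ - D₂‖ ≤ κ * (b * ‖D₁ - D₂‖) := hlip.trans (mul_le_mul_of_nonneg_left h2 hκ0)
  by_contra hne
  have hpos : 0 < ‖D₁ - D₂‖ := norm_pos_iff.mpr (sub_ne_zero.mpr hne)
  nlinarith

omit [CompleteSpace X] in
/-- **The real local solution is the only solution with argument in the contraction ball**: if
`Eq17Local ℝ b₀ h C̃ r δ Dt` holds with the data of `exists_eq17Local_real_core` (`‖DC̃‖ ≤ κ` on `‖Y‖ < ρ ≤ R`,
`κb < 1`, `r + bδ ≤ ρ`), then for `‖A‖ < r` every fixed point `D` of `D ↦ C̃(A − hD)` with `‖A − hD‖ < ρ` equals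
`Dt A` — uniqueness beyond the ball `‖D‖ ≤ δ` of the definition, in the space where [7] p. 286 places it.
[cite: Balaban1985UV3, (17) pp.259–260] -/
theorem Eq17Local.eq_of_isFixedPt_real {b₀ : C → β} {h : C → X →ₗ[ℝ] X} {Ct : (β → X) → C → X}
    {R ρ κ b r δ : ℝ} {Dt : (β → X) → (C → X)} (h17 : Eq17Local ℝ b₀ (fun c => ⇑(h c)) Ct r δ Dt)
    (hCω : ContDiffOn ℝ ω Ct (ball 0 R)) (hρR : ρ ≤ R) (hκ0 : 0 ≤ κ)
    (hκ : ∀ Y : β → X, ‖Y‖ < ρ → ‖fderiv ℝ Ct Y‖ ≤ κ) (hb : 0 ≤ b) (hh : ∀ c x, ‖h c x‖ ≤ b * ‖x‖)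
    (hκb : κ * b < 1) (hrad : r + b * δ ≤ ρ) {A : β → X} (hA : ‖A‖ < r) {D : C → X}
    (hD : ‖A - hOpLin b₀ h D‖ < ρ) (hfixD : Function.IsFixedPt (fpMap b₀ (fun c => ⇑(h c)) Ct A) D) :
    D = Dt A := by
  obtain ⟨-, -, hloc, -, -, -⟩ := h17
  obtain ⟨hfixDt, hball, -⟩ := hloc A hA
  have hHop : ∀ D : C → X, ‖hOpLin b₀ h D‖ ≤ b * ‖D‖ := norm_hOpLin_le b₀ h hb hh
  have hargDt : ‖A - hOpLin b₀ h (Dt A)‖ < ρ :=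
    calc ‖A - hOpLin b₀ h (Dt A)‖ ≤ ‖A‖ + ‖hOpLin b₀ h (Dt A)‖ := norm_sub_le _ _
      _ < r + b * δ := add_lt_add_of_lt_of_le hA ((hHop _).trans (mul_le_mul_of_nonneg_left hball hb))
      _ ≤ ρ := hrad
  exact eq_of_isFixedPt_of_fderiv_le b₀ h hCω hρR hκ0 hκ hb hh hκb hD hargDt hfixD hfixDt

/-- **(17) over the reals WITH print's uniqueness clause** — the ℝ mirror of `exists_solution`: if `C̃` is `C^ω` on a
ball `‖Y‖ < R` around `0` with `C̃(0) = 0`, `DC̃(0) = 0`, and `h(c)` are linear with `‖h c x‖ ≤ b‖x‖`, then there are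
radii `r, δ > 0` and a map `Dt` with `Eq17Local ℝ b₀ h C̃ r δ Dt` such that, for `‖A‖ < r`, (a) the solution lies
in print's solution space, `‖hD̃(A)‖ < 3r`, and (b) it is the ONLY fixed point `D` of `D ↦ C̃(A − hD)` with
`‖hD‖ < 3r` ([7] p. 286: «exactly one fixed point … It satisfies the bound |D(A′)| < ε₃/B₀»; with the radii of
`exists_eq17Local_real`, `r = ρ/4`, the arguments `A − hD` stay in the ball `ρ` on which `‖DC̃‖ ≤ (2(b+1))⁻¹`).
[cite: Balaban1985UV3, (17) pp.259–260] -/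
theorem exists_solution_real (b₀ : C → β) (h : C → X →ₗ[ℝ] X) {Ct : (β → X) → C → X} {R b : ℝ}
    (hR : 0 < R) (hCω : ContDiffOn ℝ ω Ct (ball 0 R)) (hC0 : Ct 0 = 0) (hDC0 : fderiv ℝ Ct 0 = 0)
    (hb : 0 ≤ b) (hh : ∀ c x, ‖h c x‖ ≤ b * ‖x‖) :
    ∃ r δ : ℝ, 0 < r ∧ 0 < δ ∧ ∃ Dt : (β → X) → (C → X), Eq17Local ℝ b₀ (fun c => ⇑(h c)) Ct r δ Dt ∧
      (∀ A : β → X, ‖A‖ < r → ‖hOpLin b₀ h (Dt A)‖ < 3 * r) ∧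
      ∀ A : β → X, ‖A‖ < r → ∀ D : C → X, ‖hOpLin b₀ h D‖ < 3 * r →
        Function.IsFixedPt (fpMap b₀ (fun c => ⇑(h c)) Ct A) D → D = Dt A := by
  have hb1 : 0 < b + 1 := by linarith
  set κ : ℝ := 1 / 2 / (b + 1) with hκdef
  have hκ0 : 0 < κ := by positivity
  obtain ⟨ρ, hρ, hρR, hκ⟩ := exists_radius_norm_fderiv_le hR hCω hDC0 hκ0
  set r : ℝ := ρ / 4 with hrdef
  set δ : ℝ := ρ / 4 / (b + 1) with hδdef
  have hr : 0 < r := by positivity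
  have hδ : 0 < δ := by positivity
  have h1 : b / (b + 1) ≤ 1 := (div_le_one hb1).mpr (by linarith)
  have hκb : κ * b < 1 := by
    have : κ * b = b / (b + 1) / 2 := by rw [hκdef]; ring
    rw [this]; linarith
  have hbδ : b * δ ≤ ρ / 4 := by
    calc b * δ = b / (b + 1) * (ρ / 4) := by rw [hδdef]; ring
      _ ≤ 1 * (ρ / 4) := mul_le_mul_of_nonneg_right h1 (by positivity)
      _ = ρ / 4 := one_mul _
  have hrad : r + b * δ ≤ ρ := by rw [hrdef]; linarith
  have hself : κ * (r + b * δ) ≤ δ := by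
    calc κ * (r + b * δ) ≤ κ * (ρ / 2) := mul_le_mul_of_nonneg_left (by rw [hrdef]; linarith) hκ0.le
      _ = δ := by rw [hκdef, hδdef]; ring
  obtain ⟨Dt, h17⟩ :=
    exists_eq17Local_real_core b₀ h hCω hC0 hDC0 hρR hκ0.le hκ hb hh hκb hr hδ.le hrad hself
  have hHop : ∀ D : C → X, ‖hOpLin b₀ h D‖ ≤ b * ‖D‖ := norm_hOpLin_le b₀ h hb hh
  refine ⟨r, δ, hr, hδ, Dt, h17, fun A hA => ?_, fun A hA D hD hfixD => ?_⟩
  · obtain ⟨-, -, hloc, -, -, -⟩ := h17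
    obtain ⟨-, hball, -⟩ := hloc A hA
    calc ‖hOpLin b₀ h (Dt A)‖ ≤ b * ‖Dt A‖ := hHop _
      _ ≤ b * δ := mul_le_mul_of_nonneg_left hball hb
      _ ≤ ρ / 4 := hbδ
      _ = r := by rw [hrdef]
      _ < 3 * r := by linarith
  · have hDρ : ‖A - hOpLin b₀ h D‖ < ρ :=
      calc ‖A - hOpLin b₀ h D‖ ≤ ‖A‖ + ‖hOpLin b₀ h D‖ := norm_sub_le _ _
        _ < r + 3 * r := add_lt_add hA hD
        _ = ρ := by rw [hrdef]; ring
    exact h17.eq_of_isFixedPt_real hCω hρR hκ0.le hκ hb hh hκb hrad hA hDρ hfixD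

/-- **«There exists a unique solution D̃ of this equation for A sufficiently small»** (p. 260) over the reals, as an
`∃!` in print's solution space: for some `r > 0` and every `‖A‖ < r` there is EXACTLY ONE `D` with `‖hD‖ < 3r`
solving `D = C̃(A − hD)`; it is the `Dt A` of `exists_solution_real`. [cite: Balaban1985UV3, (17) pp.259–260] -/
theorem existsUnique_solution_real (b₀ : C → β) (h : C → X →ₗ[ℝ] X) {Ct : (β → X) → C → X} {R b : ℝ}
    (hR : 0 < R) (hCω : ContDiffOn ℝ ω Ct (ball 0 R)) (hC0 : Ct 0 = 0) (hDC0 : fderiv ℝ Ct 0 = 0)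
    (hb : 0 ≤ b) (hh : ∀ c x, ‖h c x‖ ≤ b * ‖x‖) :
    ∃ r : ℝ, 0 < r ∧ ∀ A : β → X, ‖A‖ < r →
      ∃! D : C → X, ‖hOpLin b₀ h D‖ < 3 * r ∧ Function.IsFixedPt (fpMap b₀ (fun c => ⇑(h c)) Ct A) D := by
  obtain ⟨r, δ, hr, -, Dt, h17, hin, huniq⟩ := exists_solution_real b₀ h hR hCω hC0 hDC0 hb hh
  refine ⟨r, hr, fun A hA => ⟨Dt A, ⟨hin A hA, ?_⟩, fun D hD => huniq A hA D hD.1 hD.2⟩⟩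
  obtain ⟨-, -, hloc, -, -, -⟩ := h17
  exact (hloc A hA).1

end RealUnique

end Literature.MathematicalPhysics.QuantumFieldTheory.Balaban1983to89.B10Eq17LocalSolution
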